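import Summits.BirchSwinnertonDyer.BirchSwinnertonDyer.Theorems.EisensteinPrimesBSDpOnCellCSplitPartner
import HarnessLib

/-!
# Crux 4 `BSDpOnCellC` (stmt-BirchSwinnertonDyer-19034), line b1 v9: the two «value typed» roads with the
# Heegner field `K` SUPPLIED BY THE CALLER and the CGLS partner's rank-zero `p`-part asked ONLY for the twist
# by THAT `d_K` — the pointwise half of the per-pair TWIST-CERTIFICATE road on the ψ-odd (`GVPar`) B11 rows
# (cell `bsd-eis`, seat `bsd-eis-cgshw` g15; part 1 of 2, part 2 = `…TwistCertificate.lean`)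

HONEST FRAMING (cell `bsd-eis`, run/shared/lean/pub/bsd-eis/): theorems only; nothing booked; X2 stays
CONSTRUCTION-SHAPED; no label or count moves; BSD is not proved by any of this. Every theorem is CONDITIONAL on
its displayed binders — in particular on the re-oriented IMC atom (`X2.Nonsplit/SplitIMCEqOnTreeIntOther`, the
Keller–Yin 2024 Thm. D = Thm. 5.1.3 shape, an UNREFEREED PREPRINT gapped at L1754), on the typed value atom
(`X2.Nonsplit/SplitBDPValueOnTreeInt` — supplied at EVERY odd `p` by the refereed Liu–Zhang–Zhang fact through
`X2.LZZRoadInputIoo`, chain of record RULING L56 (5)), on Hsieh 2014 Thm. 1 (`hH`, PUB) and on the caller's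
PARTNER INPUT `htwist` for the ONE field `K` it names.

## What is here and why

Every b1 road of record (`…_of_partner`, p488440 / p488442 / `…SplitPartner.lean`) CHOOSES its auxiliary Heegner
field inside the proof (`X2.exists_admissibleField_of_rootNumber_eq_neg_one`, Hoffstein–Luo), so its partner
hypothesis must cover EVERY admissible `K`: `∀ K, … → ∀ Wd ≅ E^{(d_K)}, r_an(Wd) = 0 → PPartRankZero Wd p`. On the
ψ-even sub-rows that hypothesis is a theorem (the twist lies in X2a, `X2.pPartRankZero_twist_of_not_gvPar`); on the
ψ-ODD sub-rows (`CellCNonsplitGV` / `CellCSplitGV`: 1 522 + 1 625 cells @3, 73 + 133 @5, 4 + 16 @7 in the O9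
atlas) the twist is an X2b curve with `¬GVPar` — Mazur's main conjecture there is crux 3 (`MazurMCOnCellB`, an open
problem class-wide). PER PAIR, however, ONE admissible `K` with a CLOSED partner suffices — and the partner
`E^{(d_K)}` (rank `0`, `E[p]` reducible, `p` multiplicative) is closed by Wuthrich 2014 Prop. 21 whenever
`p ∤ #Ш(E^{(d_K)})_an` (`bsdp_of_L_one_ne_zero_of_padicValRat_shaAn_eq_zero`, PUB + a numeric certificate — the
currency of the A3/A10 DESC3/DT bookings). This file re-cuts the two «value typed» roads so that `K` is an
ARGUMENT: the proofs are those of `bsdp_of_cellC_of_not_split_of_manin_of_intResidualsOther_of_partner` (p488440)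
and `bsdp_of_cellC_of_split_of_manin_of_intResidualsOther_of_partner` (`…SplitPartner.lean`) VERBATIM from the
point where `K` has been obtained (Heegner datum, Gross–Zagier non-torsion, Néron model of the twist,
`twistTransportPackage_holds`, `(κ, γ)`, degree-one `𝔭`, then the datum-level theorems p488190), with the
Hoffstein–Luo and root-number steps removed.

* `bsdp_of_cellC_of_not_split_of_manin_of_intResidualsOther_of_twistPartner` — non-split, any odd `p`;
* `bsdp_of_cellC_of_split_of_manin_of_intResidualsOther_of_twistPartner` — split, any odd `p` (CTL-split the
  THEOREM `Theorems.CtlLoc.splitControlOnTree_of_cellC`).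

References: [CastellaEtAl2021] Thm. 5.3.1 and (5.5)–(5.7); [Hsieh2014] Thm. 1; [KellerYin2024] Thm. D = Thm. 5.1.3
(PRE); [Castella2018] Thm. 2.3, §5; [GrossZagier1986] I.(6.3); [Wuthrich2014] Prop. 21; [Miller2011LMS] Def. 1.1;
RULINGS L31 / L34 / L56 / L57; cgshw MEMO-16/18/19.
-/

set_option autoImplicit false
set_option linter.dupNamespace false

noncomputable section

open scoped Classical MatrixGroups ModularForm Topology

open Filter CongruenceSubgroup WeierstrassCurve NumberField IsDedekindDomain Field PowerSeries
  Literature.NumberTheory.EllipticCurves Literature.NumberTheory.EllipticCurves.GreenbergSelmer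
  Literature.NumberTheory.EllipticCurves.ModularForms Literature.NumberTheory.QuadraticFields
  Literature.NumberTheory.EllipticCurves.Rank1Residual
  Literature.NumberTheory.EllipticCurves.Rank1Residual.Typed
  Literature.NumberTheory.EllipticCurves.KrizLi2019
  Literature.NumberTheory.EllipticCurves.GreenbergVatsal2000
  Literature.NumberTheory.EllipticCurves.Wuthrich2014
  Literature.NumberTheory.EllipticCurves.SteinWuthrich2013
  Literature.NumberTheory.EllipticCurves.Castella2018
  Literature.NumberTheory.EllipticCurves.Castella2018Exceptional
  Literature.NumberTheory.GaloisRepresentations Literature.NumberTheory.GaloisCohomology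
  Literature.NumberTheory.Automorphic
  Summit.BirchSwinnertonDyer.Rank1Residual.X11b.AcSelmer
  Summit.BirchSwinnertonDyer.Rank1Residual.X11b.Halves
  Summit.BirchSwinnertonDyer.Rank1Residual.X11b
  Summit.BirchSwinnertonDyer.Rank1Residual.X2
  Summit.BirchSwinnertonDyer.Rank1Residual

namespace Summit.BirchSwinnertonDyer.BirchSwinnertonDyer.Theorems.Reoriented

/-! ### The two «value typed» roads with `K` supplied -/

section TwistPartner

variable (W : WeierstrassCurve ℚ) [W.IsElliptic] [W.IsGloballyMinimal] (p : ℕ) [Fact p.Prime]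

/-- **X2c ∩ {NON-SPLIT}, any odd `p`, pointwise with a Manin datum, `K` SUPPLIED, partner asked for the twist by
`d_K` only.** Hypotheses: the published inputs of p488440; `hc : CellC W p`, `hns`, a prime-to-`p` Manin datum; the
value atom `h2 : X2.NonsplitBDPValueOnTreeInt W p` and the re-oriented IMC atom `h3 : X2.NonsplitIMCEqOnTreeIntOther W p`;
an ADMISSIBLE field `K` (imaginary quadratic, `d_K` odd and `< −4`, Heegner for `N_E` and for `p`,
`L(E^{(d_K)},1) ≠ 0`); and `htwist`: every globally minimal model `Wd` of `E^{(d_K)}` with `r_an(Wd) = 0` has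
`PPartRankZero Wd p`. Conclusion `BSDp W p`. Proof = p488440's from the point where `K` is in hand. CONDITIONAL on
every listed binder; nothing booked. [cite: CastellaEtAl2021, Thm. 5.3.1 and (5.5)–(5.7)]
[cite: Hsieh2014, Thm. 1 (arXiv:1112.1580 pp. 3–4)] [claim: KellerYin2024, status: under-review]
[cite: GrossZagier1986, I.(6.3)] [cite: Miller2011LMS, Def. 1.1] -/
theorem bsdp_of_cellC_of_not_split_of_manin_of_intResidualsOther_of_twistPartner
    (hnf : exists_isNewformOf)
    (hPT : ∀ (K : Type) [Field K] [NumberField K], poitouTate_selmerStructure_duality K)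
    (hPT2 : ∀ (K : Type) [Field K] [NumberField K], poitouTate_sha_tateDual K)
    (hEP : ∀ (K : Type) [Field K] [NumberField K] (v : HeightOneSpectrum (𝓞 K)),
      localEulerPoincareCharacteristic (v.adicCompletion K))
    (hcd : fieldCdLE_two_of_numberField)
    (hBr : ∀ (K : Type) [Field K] [NumberField K] (p : ℕ) [Fact p.Prime],
      ZpExtension.decomp_not_le_kerSubgroup_of_isAnticyclotomic K p)
    (hH : hsieh2014_exists_anticyclotomicPAdicLFunction)
    (hGZ : ∀ (N : ℕ) [NeZero N] (W : WeierstrassCurve ℚ) (K : Type) [Field K] [NumberField K],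
      gross_zagier N W K)
    (hKo : ∀ (N : ℕ) [NeZero N] (W : WeierstrassCurve ℚ) (K : Type) [Field K] [NumberField K],
      kolyvagin N W K)
    (hHP : ∀ (N : ℕ) [NeZero N] (W : WeierstrassCurve ℚ) (K : Type) [Field K] [NumberField K],
      heegnerPointComplex_mem_range_map N W K)
    (hGZK : rank_eq_analyticRank_of_analyticRank_le_one)
    (hc : CellC W p) (hns : ¬ W.HasSplitMultiplicativeReductionAtPrime p)
    (hMan : HasPrimeToManinDatum W p)
    (h2 : NonsplitBDPValueOnTreeInt W p) (h3 : NonsplitIMCEqOnTreeIntOther W p)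
    (K : Type) [Field K] [NumberField K] (hK : IsImaginaryQuadratic K)
    (hodd : Odd (NumberField.discr K)) (hlt : NumberField.discr K < -4)
    (hHN : SatisfiesHeegnerHypothesis (W.conductorNorm ℤ) K) (hHp : SatisfiesHeegnerHypothesis p K)
    (hLK : (W.quadraticTwist (NumberField.discr K : ℚ)).entireLFunction 1 ≠ 0)
    (htwist : ∀ (Wd : WeierstrassCurve ℚ) [Wd.IsElliptic] [Wd.IsGloballyMinimal],
        (∃ C : VariableChange ℚ, C • Wd = W.quadraticTwist (NumberField.discr K : ℚ)) →
        Wd.analyticRank = 0 → PPartRankZero Wd p) :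
    BSDp W p := by
  have hp : p.Prime := Fact.out
  have hmod : hasEntireLFunction_rat := WeierstrassCurve.hasEntireLFunction_rat_of_exists_isNewformOf hnf
  obtain ⟨hr, hp2, hred, hmult⟩ := hc
  haveI : NeZero (W.conductorNorm ℤ) := ⟨(W.conductorNorm_pos_holds).ne'⟩
  -- the datum with `p ∤ c`, a Heegner datum and the `K`-rational Heegner point
  obtain ⟨Dt, hcM⟩ := hMan
  obtain ⟨β, hβ⟩ := exists_dvd_sq_sub_discr_holds (W.conductorNorm ℤ) K hK hHN
  obtain ⟨H, -⟩ := nonempty_heegnerDatum_holds (W.conductorNorm ℤ) K hK hβ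
  obtain ⟨ι⟩ : Nonempty (K →+* ℂ) := inferInstance
  obtain ⟨P, hP⟩ := hHP (W.conductorNorm ℤ) W K hK hHN Dt H ι
  -- the Heegner point has infinite order: `L'(E/K,1) = L'(E,1)·L(E^K,1) ≠ 0` (Gross–Zagier)
  have hL0 : W.entireLFunction 1 = 0 := entireLFunction_one_eq_zero_of_analyticRank_eq_one hr
  obtain ⟨-, hderiv⟩ := leadingLCoeff_eq_deriv_of_analyticRank_eq_one hr
  have hLKd : LDerivEK W K ≠ 0 := by
    rw [lDerivEK_eq_deriv_mul W K hmod hL0]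
    exact mul_ne_zero hderiv hLK
  have hPH : IsHeegnerPoint (W.conductorNorm ℤ) W K P := ⟨Dt, H, ι, hP⟩
  have hPinf : ¬ IsOfFinAddOrder P :=
    (lDerivEK_ne_zero_iff_not_isOfFinAddOrder W (W.conductorNorm ℤ) K (hGZ _ W K) hK hHN hPH).mp hLKd
  -- a globally minimal model of the twist (Néron) and its transport values
  have hD0 : (NumberField.discr K : ℚ) ≠ 0 := by exact_mod_cast NumberField.discr_ne_zero K
  haveI hEt : (W.quadraticTwist (NumberField.discr K : ℚ)).IsElliptic :=
    W.isElliptic_quadraticTwist hD0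
  obtain ⟨Cd, hCd⟩ := hasGlobalMinimalModel_rat_holds (W.quadraticTwist (NumberField.discr K : ℚ))
  set Wd : WeierstrassCurve ℚ := Cd • W.quadraticTwist (NumberField.discr K : ℚ) with hWd_def
  haveI : Wd.IsGloballyMinimal := hCd
  have hWd : Cd • W.quadraticTwist (NumberField.discr K : ℚ) = Wd := rfl
  have hC : Cd⁻¹ • Wd = W.quadraticTwist (NumberField.discr K : ℚ) := by
    rw [← hWd, inv_smul_smul]
  obtain ⟨htam, hu⟩ := twistTransportPackage_holds W p K Wd Cd ⟨hr, hp2, hred, hmult⟩ hK hodd hHN hWd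
  have htamK : padicValNat p (W.baseChange K).tamagawaProduct = 2 * padicValNat p W.tamagawaProduct :=
    padicValNat_tamagawaProduct_baseChange_of_heegner_odd W p hp2 K hK hodd hHN hHp
  -- the twist has analytic rank `0`; its rank-zero `p`-part from the supply AT THIS `K`
  have hLd : Wd.entireLFunction 1 ≠ 0 := by
    rw [← hWd, entireLFunction_smul]; exact hLK
  have hrd : Wd.analyticRank = 0 := (Wd.analyticRank_eq_zero_iff_holds (hmod _)).2 hLd
  have htw : PPartRankZero Wd p := htwist Wd ⟨Cd⁻¹, hC⟩ hrd
  -- the anticyclotomic `ℤ_p`-extension, a topological generator, a degree-one prime above `p`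
  haveI : IsTotallyComplex K := hK.2
  obtain ⟨κ, hκ⟩ := ZpExtension.exists_isAnticyclotomic_holds (K := K) (p := p) hK.1
    (fun w ↦ IsTotallyComplex.isComplex w)
  obtain ⟨γ, hγ⟩ := κ.surjective (Multiplicative.ofAdd 1)
  haveI : Fact (κ.IsTopGenerator γ) := ⟨hγ⟩
  obtain ⟨𝔭, h𝔭, he, hf⟩ := X11b.exists_degreeOnePrime_of_splitsIn K p hK.1 (hHp p hp dvd_rfl)
  -- conclude by the datum-level road (p488190)
  exact bsdp_of_cellC_of_not_split_of_hsieh2014_of_intHalvesOther_of_partner W p hnf hPT hPT2 hEP hcd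
    hBr hH (W.conductorNorm ℤ) K Dt H ι P (hGZ _ W K) (hKo _ W K) hGZK ⟨hr, hp2, hred, hmult⟩ hns rfl
    hK hlt hodd hHN hHp hP hPinf hcM hLK Wd Cd hWd htw htam hu htamK κ hκ γ 𝔭 h𝔭 he hf h2 h3

/-- **X2c ∩ {SPLIT}, any odd `p`, pointwise with a Manin datum, `K` SUPPLIED, partner asked for the twist by
`d_K` only** — the split twin: value atom `h2 : X2.SplitBDPValueOnTreeInt W p`, re-oriented IMC atom
`h3 : X2.SplitIMCEqOnTreeIntOther W p`, CTL-split the THEOREM `Theorems.CtlLoc.splitControlOnTree_of_cellC`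
(k5-c4 g5); proof = `bsdp_of_cellC_of_split_of_manin_of_intResidualsOther_of_partner`'s from the point where `K`
is in hand. CONDITIONAL on every listed binder; nothing booked. [cite: Hsieh2014, Thm. 1 (arXiv:1112.1580 pp. 3–4)]
[claim: KellerYin2024, status: under-review] [cite: Castella2018, Thm. 2.3 and §5 (5.1)–(5.3) (arXiv:1704.06608 pp. 5, 12)]
[cite: CastellaEtAl2021, Thm. 5.3.1 and (5.5)–(5.7)] [cite: Miller2011LMS, Def. 1.1] -/
theorem bsdp_of_cellC_of_split_of_manin_of_intResidualsOther_of_twistPartner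
    (hnf : exists_isNewformOf)
    (hPT : ∀ (K : Type) [Field K] [NumberField K], poitouTate_selmerStructure_duality K)
    (hPT2 : ∀ (K : Type) [Field K] [NumberField K], poitouTate_sha_tateDual K)
    (hEP : ∀ (K : Type) [Field K] [NumberField K] (v : HeightOneSpectrum (𝓞 K)),
      localEulerPoincareCharacteristic (v.adicCompletion K))
    (hBr : ∀ (K : Type) [Field K] [NumberField K] (p : ℕ) [Fact p.Prime],
      ZpExtension.decomp_not_le_kerSubgroup_of_isAnticyclotomic K p)
    (hH : hsieh2014_exists_anticyclotomicPAdicLFunction)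
    (hGZ : ∀ (N : ℕ) [NeZero N] (W : WeierstrassCurve ℚ) (K : Type) [Field K] [NumberField K],
      gross_zagier N W K)
    (hKo : ∀ (N : ℕ) [NeZero N] (W : WeierstrassCurve ℚ) (K : Type) [Field K] [NumberField K],
      kolyvagin N W K)
    (hHP : ∀ (N : ℕ) [NeZero N] (W : WeierstrassCurve ℚ) (K : Type) [Field K] [NumberField K],
      heegnerPointComplex_mem_range_map N W K)
    (hGZK : rank_eq_analyticRank_of_analyticRank_le_one)
    (hc : CellC W p) (hs : W.HasSplitMultiplicativeReductionAtPrime p)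
    (hMan : HasPrimeToManinDatum W p)
    (h2 : SplitBDPValueOnTreeInt W p) (h3 : SplitIMCEqOnTreeIntOther W p)
    (K : Type) [Field K] [NumberField K] (hK : IsImaginaryQuadratic K)
    (hodd : Odd (NumberField.discr K)) (hlt : NumberField.discr K < -4)
    (hHN : SatisfiesHeegnerHypothesis (W.conductorNorm ℤ) K) (hHp : SatisfiesHeegnerHypothesis p K)
    (hLK : (W.quadraticTwist (NumberField.discr K : ℚ)).entireLFunction 1 ≠ 0)
    (htwist : ∀ (Wd : WeierstrassCurve ℚ) [Wd.IsElliptic] [Wd.IsGloballyMinimal],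
        (∃ C : VariableChange ℚ, C • Wd = W.quadraticTwist (NumberField.discr K : ℚ)) →
        Wd.analyticRank = 0 → PPartRankZero Wd p) :
    BSDp W p := by
  have hp : p.Prime := Fact.out
  have hmod : hasEntireLFunction_rat := WeierstrassCurve.hasEntireLFunction_rat_of_exists_isNewformOf hnf
  have hCTL : SplitControlOnTree W p :=
    CtlLoc.splitControlOnTree_of_cellC W p hGZK hnf hPT hPT2 hEP hBr hc hs
  obtain ⟨hr, hp2, hred, hmult⟩ := hc
  haveI : NeZero (W.conductorNorm ℤ) := ⟨(W.conductorNorm_pos_holds).ne'⟩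
  -- the datum with `p ∤ c`, a Heegner datum and the `K`-rational Heegner point
  obtain ⟨Dt, hcM⟩ := hMan
  obtain ⟨β, hβ⟩ := exists_dvd_sq_sub_discr_holds (W.conductorNorm ℤ) K hK hHN
  obtain ⟨H, -⟩ := nonempty_heegnerDatum_holds (W.conductorNorm ℤ) K hK hβ
  obtain ⟨ι⟩ : Nonempty (K →+* ℂ) := inferInstance
  obtain ⟨P, hP⟩ := hHP (W.conductorNorm ℤ) W K hK hHN Dt H ι
  -- the Heegner point has infinite order (Gross–Zagier)
  have hL0 : W.entireLFunction 1 = 0 := entireLFunction_one_eq_zero_of_analyticRank_eq_one hr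
  obtain ⟨-, hderiv⟩ := leadingLCoeff_eq_deriv_of_analyticRank_eq_one hr
  have hLKd : LDerivEK W K ≠ 0 := by
    rw [lDerivEK_eq_deriv_mul W K hmod hL0]
    exact mul_ne_zero hderiv hLK
  have hPH : IsHeegnerPoint (W.conductorNorm ℤ) W K P := ⟨Dt, H, ι, hP⟩
  have hPinf : ¬ IsOfFinAddOrder P :=
    (lDerivEK_ne_zero_iff_not_isOfFinAddOrder W (W.conductorNorm ℤ) K (hGZ _ W K) hK hHN hPH).mp hLKd
  -- a globally minimal model of the twist (Néron) and its transport values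
  have hD0 : (NumberField.discr K : ℚ) ≠ 0 := by exact_mod_cast NumberField.discr_ne_zero K
  haveI hEt : (W.quadraticTwist (NumberField.discr K : ℚ)).IsElliptic :=
    W.isElliptic_quadraticTwist hD0
  obtain ⟨Cd, hCd⟩ := hasGlobalMinimalModel_rat_holds (W.quadraticTwist (NumberField.discr K : ℚ))
  set Wd : WeierstrassCurve ℚ := Cd • W.quadraticTwist (NumberField.discr K : ℚ) with hWd_def
  haveI : Wd.IsGloballyMinimal := hCd
  have hWd : Cd • W.quadraticTwist (NumberField.discr K : ℚ) = Wd := rfl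
  have hC : Cd⁻¹ • Wd = W.quadraticTwist (NumberField.discr K : ℚ) := by
    rw [← hWd, inv_smul_smul]
  obtain ⟨htam, hu⟩ := twistTransportPackage_holds W p K Wd Cd ⟨hr, hp2, hred, hmult⟩ hK hodd hHN hWd
  have htamK : padicValNat p (W.baseChange K).tamagawaProduct = 2 * padicValNat p W.tamagawaProduct :=
    padicValNat_tamagawaProduct_baseChange_of_heegner_odd W p hp2 K hK hodd hHN hHp
  -- the twist has analytic rank `0`; its rank-zero `p`-part from the supply AT THIS `K`
  have hLd : Wd.entireLFunction 1 ≠ 0 := by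
    rw [← hWd, entireLFunction_smul]; exact hLK
  have hrd : Wd.analyticRank = 0 := (Wd.analyticRank_eq_zero_iff_holds (hmod _)).2 hLd
  have htw : PPartRankZero Wd p := htwist Wd ⟨Cd⁻¹, hC⟩ hrd
  -- the anticyclotomic `ℤ_p`-extension, a topological generator, a degree-one prime above `p`
  haveI : IsTotallyComplex K := hK.2
  obtain ⟨κ, hκ⟩ := ZpExtension.exists_isAnticyclotomic_holds (K := K) (p := p) hK.1
    (fun w ↦ IsTotallyComplex.isComplex w)
  obtain ⟨γ, hγ⟩ := κ.surjective (Multiplicative.ofAdd 1)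
  haveI : Fact (κ.IsTopGenerator γ) := ⟨hγ⟩
  obtain ⟨𝔭, h𝔭, he, hf⟩ := X11b.exists_degreeOnePrime_of_splitsIn K p hK.1 (hHp p hp dvd_rfl)
  -- conclude by the datum-level road (p488190)
  exact bsdp_of_cellC_of_split_of_hsieh2014_of_intHalvesOther_of_partner W p hGZK hnf hH
    (W.conductorNorm ℤ) K Dt H ι P (hGZ _ W K) (hKo _ W K) ⟨hr, hp2, hred, hmult⟩ hs rfl hK hlt hodd
    hHN hHp hP hPinf hcM hLK Wd Cd hWd htw htam hu htamK κ hκ γ 𝔭 h𝔭 he hf h2 h3 hCTL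

end TwistPartner

end Summit.BirchSwinnertonDyer.BirchSwinnertonDyer.Theorems.Reoriented

end
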